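import Mathlib.Algebra.Order.Archimedean.Basic
import Mathlib.Topology.MetricSpace.ProperSpace
import Literature.Analysis.FluidPDE.ChaeWolfRemovingDSS
import Literature.Analysis.FluidPDE.ScalingUniformRecurrence
import HarnessLib

/-!
# Chae–Wolf 2017, Theorem 1.1 — Step 5: the Type I bound from discrete self-similarity

Analysis/FluidPDE proofs file (theorems only; no definitions, no named facts) on the discharge
path of the named fact `Literature.Analysis.FluidPDE.chaeWolf2017_dss_typeI_decay`
(`ChaeWolfRemovingDSS.lean`; D. Chae, J. Wolf, *Removing discretely self-similar singularities
for the 3D Navier–Stokes equations*, Comm. PDE 42 (2017) 1359–1374 = arXiv:1610.09464,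
**Theorem 1.1**, estimate (1.5)). This file is the purely kinematic last step of the printed
proof (§2, Step 5, arXiv p. 7): "According to step 4, where we have shown that `u` is bounded in
any set `ℝ³ × (−∞,0) ∖ Q(0,r)`, it holds `|u(x,t)| ≤ C` for all
`(x,t) ∈ Q̄(0,λ) ∖ Q(0,1)` (2.19). Now let `(x,t) ∈ Q̄ ∖ {(0,0)}`. Then there exists `k ∈ ℤ`
such that `(x,t) ∈ Q̄(0,λ^{k+1}) ∖ Q(0,λᵏ)`. Thus `(λ^{-k}x, λ^{-2k}t) ∈ Q̄(0,λ) ∖ Q(0,1)`. In view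
of (1.2) and (2.19) … `|u(x,t)| = λ^{-k}|u(λ^{-k}x, λ^{-2k}t)| ≤ λ^{-k}C`. As
`√(−t) + |x| ≤ 2 max{|x|, √(−t)} ≤ 2λ^{k+1}` … `|u(x,t)| ≤ 2Cλ/(√(−t) + |x|)`."

We prove it in the form in which the regularity step feeds it: a `c`-discretely self-similar
field (`IsDiscretelySelfSimilar c u`, `1 < c`: `c u(c²t, cx) = u(t, x)`) which is continuous on
`(−∞, 0) × E` and bounded on a far-field region `(−δ, 0) × {‖x‖ > R}` obeys a Type I bound
`‖u(t,x)‖ ≤ C/(‖x‖ + √(−t))` (`HasTypeIDecay C u`):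

* `norm_eq_zpow_mul_norm` — the iterated scaling relation `‖u(t,x)‖ = cⁿ ‖u(c²ⁿt, cⁿx)‖`,
  `n ∈ ℤ` (from the tree's `IsDiscretelySelfSimilar.zpow`);
* `norm_le_div_sqrt_of_strip_bound` — a bound `M` on a time strip `[c²a, a] × E`, `a < 0`,
  propagates to the Type I rate in time, `‖u(t,x)‖ ≤ M c √(−a)/√(−t)` for all `t < 0`
  (every `t < 0` is carried into the strip by a unique power `c²ⁿ`; Mathlib's
  `exists_mem_Ico_zpow`);
* `norm_le_div_norm_of_farField_bound` — a bound `M` on `(−δ, 0) × {‖y‖ > R}` propagates to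
  the spatial rate `‖u(t,x)‖ ≤ cRM/‖x‖` in the region `cR√(−t) < √δ ‖x‖`;
* `hasTypeIDecay_of_time_and_space_decay` — the two rates combine to `HasTypeIDecay`;
* `exists_hasTypeIDecay_of_farField_bound` — the assembled Step 5 (continuity supplies the bound
  on the compact part `[−δ/2, −δ/(2c²)] × B̄(0, R)` of the strip), and its specialisation to the
  velocity of a classical solution on the time set `(−∞, 0)`
  (`IsClassicalNSSolutionOn.exists_hasTypeIDecay_of_farField_bound`).

The regularity input of Theorem 1.1 (boundedness near `t = 0` away from the origin, §2 Steps
1–4) is NOT in this file.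

## Mathlib / tree search

Tree: `IsDiscretelySelfSimilar`, `nsRescale_apply`, `HasTypeIDecay` (`SelfSimilar.lean`),
`IsDiscretelySelfSimilar.zpow` (`ScalingUniformRecurrence.lean`), `IsClassicalNSSolutionOn`,
`IsSmoothSpaceTimeOn` (`ClassicalSolution.lean`); `lean search 'HasTypeIDecay'` shows no
derivation of a Type I bound from discrete self-similarity (`HasTypeIDecay.nsRescale` is the
converse bookkeeping). Mathlib: `exists_mem_Ico_zpow`, `IsCompact.exists_bound_of_continuousOn`,
`isCompact_Icc`, `isCompact_closedBall` (proper spaces), `Real.sqrt_lt_sqrt`, `Real.sqrt_inv`,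
`Real.lt_sqrt`, `Real.sqrt_lt'`.

## References

* D. Chae, J. Wolf, Comm. PDE 42 (2017) 1359–1374 = arXiv:1610.09464, §2, proof of Thm. 1.1,
  Step 5 ((2.19) and the display after it, arXiv p. 7); (1.2) (`λ`-DSS); Thm. 1.1 with (1.5)
  (p. 3). [ChaeWolf2017RemovingDSS]
-/

noncomputable section

open Set Function Metric

namespace Literature.Analysis.FluidPDE

namespace ChaeWolfDecay

variable {E : Type*} [NormedAddCommGroup E] [NormedSpace ℝ E]
variable {F : Type*} [NormedAddCommGroup F] [NormedSpace ℝ F]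

/-! ### Iterated discrete self-similarity -/

/-- Pointwise form of the iterated scaling relation of a `c`-DSS field, `c ≠ 0`:
`u(t, x) = cⁿ • u(c²ⁿ t, cⁿ x)` for every `n ∈ ℤ` (Chae–Wolf 2017, (1.2) iterated:
`u = u_{λᵏ}`). [cite: ChaeWolf2017RemovingDSS, (1.2) and §2 Step 5 (arXiv p. 7)] -/
theorem apply_eq_zpow_smul {c : ℝ} (hc : c ≠ 0) {u : ℝ → E → F}
    (h : IsDiscretelySelfSimilar c u) (n : ℤ) (t : ℝ) (x : E) :
    u t x = c ^ n • u ((c ^ n) ^ 2 * t) (c ^ n • x) := by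
  have key := congrFun (congrFun (h.zpow hc n) t) x
  rw [nsRescale_apply] at key
  exact key.symm

/-- Norm form of the iterated scaling relation for `0 < c`:
`‖u(t, x)‖ = cⁿ ‖u(c²ⁿ t, cⁿ x)‖`, `n ∈ ℤ` (Chae–Wolf 2017, §2 Step 5:
"`|u(x,t)| = |u_{λ^{-k}}(x,t)| = λ^{-k}|u(λ^{-k}x, λ^{-2k}t)|`"). [cite: ChaeWolf2017RemovingDSS, §2 Step 5 (arXiv p. 7)] -/
theorem norm_eq_zpow_mul_norm {c : ℝ} (hc : 0 < c) {u : ℝ → E → F}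
    (h : IsDiscretelySelfSimilar c u) (n : ℤ) (t : ℝ) (x : E) :
    ‖u t x‖ = c ^ n * ‖u ((c ^ n) ^ 2 * t) (c ^ n • x)‖ := by
  rw [apply_eq_zpow_smul hc.ne' h n t x, norm_smul, Real.norm_of_nonneg (zpow_nonneg hc.le n)]

/-! ### The Type I rate in time from a bound on one time strip -/

/-- **A bound on one period strip gives the Type I rate in time.** If `u` is `c`-DSS, `1 < c`,
and `‖u‖ ≤ M` on the strip `[c²a, a] × E` for some `a < 0`, then
`‖u(t, x)‖ ≤ M c √(−a) / √(−t)` for all `t < 0` and all `x`: every `t < 0` is of the form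
`γ⁻² s` with `s ∈ (c²a, a]` and `γ = cⁿ`, `n ∈ ℤ`, and then `‖u(t,x)‖ = γ‖u(s, γx)‖ ≤ γM` with
`γ ≤ c√(−a)/√(−t)` (Chae–Wolf 2017, §2 Step 5, the choice of `k` with
`(x,t) ∈ Q̄(0,λ^{k+1}) ∖ Q(0,λᵏ)`). [cite: ChaeWolf2017RemovingDSS, §2 Step 5 (arXiv p. 7)] -/
theorem norm_le_div_sqrt_of_strip_bound {c : ℝ} (hc : 1 < c) {u : ℝ → E → F}
    (h : IsDiscretelySelfSimilar c u) {a M : ℝ} (ha : a < 0) (hM : 0 ≤ M)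
    (hstrip : ∀ s ∈ Icc (c ^ 2 * a) a, ∀ y : E, ‖u s y‖ ≤ M) :
    ∀ t < 0, ∀ x : E, ‖u t x‖ ≤ M * (c * Real.sqrt (-a)) / Real.sqrt (-t) := by
  intro t ht x
  have hc0 : 0 < c := one_pos.trans hc
  have hna : 0 < -a := neg_pos.2 ha
  have hnt : 0 < -t := neg_pos.2 ht
  -- the ratio `r = √((-t)/(-a))` and the power `cⁿ ≤ r < cⁿ⁺¹`
  set r : ℝ := Real.sqrt (-t / -a) with hr
  have hr0 : 0 < r := Real.sqrt_pos.2 (div_pos hnt hna)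
  obtain ⟨n, hn1, hn2⟩ := exists_mem_Ico_zpow hr0 hc
  have hg0 : 0 < c ^ n := zpow_pos hc0 n
  -- the scaling factor `γ = c⁻ⁿ`
  have hγ : c ^ (-n) = (c ^ n)⁻¹ := zpow_neg c n
  have hγ0 : 0 < c ^ (-n) := by rw [hγ]; exact inv_pos.2 hg0
  -- the rescaled time `s = γ² t` lies in the strip
  have hr2 : r ^ 2 = -t / -a := Real.sq_sqrt (div_pos hnt hna).le
  have hs1 : c ^ 2 * a ≤ (c ^ (-n)) ^ 2 * t := by
    -- `r < c^(n+1) = c^n c` gives `-t/-a < c² (cⁿ)²`, i.e. `(cⁿ)⁻² t ≥ c² a`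
    have h1 : r < c ^ n * c := by rwa [← zpow_add_one₀ hc0.ne' n]
    have h2 : r ^ 2 < (c ^ n * c) ^ 2 := by
      exact pow_lt_pow_left₀ h1 hr0.le two_ne_zero
    rw [hr2, div_lt_iff₀ hna] at h2
    rw [hγ, inv_pow, inv_mul_eq_div, le_div_iff₀ (pow_pos hg0 2)]
    nlinarith [h2]
  have hs2 : (c ^ (-n)) ^ 2 * t ≤ a := by
    -- `cⁿ ≤ r` gives `(cⁿ)² ≤ -t/-a`, i.e. `(cⁿ)⁻² t ≤ a`
    have h2 : (c ^ n) ^ 2 ≤ r ^ 2 := pow_le_pow_left₀ hg0.le hn1 2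
    rw [hr2, le_div_iff₀ hna] at h2
    rw [hγ, inv_pow, inv_mul_eq_div, div_le_iff₀ (pow_pos hg0 2)]
    nlinarith [h2]
  have key := hstrip _ ⟨hs1, hs2⟩ (c ^ (-n) • x)
  rw [norm_eq_zpow_mul_norm hc0 h (-n) t x]
  -- `γ ≤ c √(-a) / √(-t)`
  have hγle : c ^ (-n) ≤ c * Real.sqrt (-a) / Real.sqrt (-t) := by
    have hst : 0 < Real.sqrt (-t) := Real.sqrt_pos.2 hnt
    rw [hγ, le_div_iff₀ hst, inv_mul_le_iff₀ hg0]
    -- `√(-t) ≤ cⁿ c √(-a)` from `r = √(-t)/√(-a) < cⁿ c`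
    have h1 : r < c ^ n * c := by rwa [← zpow_add_one₀ hc0.ne' n]
    have hsa : 0 < Real.sqrt (-a) := Real.sqrt_pos.2 hna
    have h3 : Real.sqrt (-t) = r * Real.sqrt (-a) := by
      rw [hr, Real.sqrt_div hnt.le, div_mul_cancel₀ _ hsa.ne']
    rw [h3]
    nlinarith [h1, hsa]
  calc c ^ (-n) * ‖u ((c ^ (-n)) ^ 2 * t) (c ^ (-n) • x)‖ ≤ c ^ (-n) * M :=
        mul_le_mul_of_nonneg_left key hγ0.le
    _ ≤ c * Real.sqrt (-a) / Real.sqrt (-t) * M := mul_le_mul_of_nonneg_right hγle hM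
    _ = M * (c * Real.sqrt (-a)) / Real.sqrt (-t) := by ring

/-! ### The spatial rate from a far-field bound -/

/-- **A far-field bound gives the spatial rate `1/‖x‖`.** If `u` is `c`-DSS, `1 < c`, and
`‖u‖ ≤ M` on `(−δ, 0) × {‖y‖ > R}` (`0 < δ`, `0 < R`, `0 ≤ M`), then `‖u(t, x)‖ ≤ cRM/‖x‖`
whenever `t < 0` and `cR√(−t) < √δ ‖x‖`: with `γ = cⁿ⁺¹ ∈ (R/‖x‖, cR/‖x‖]` the point
`(γ²t, γx)` lies in the far-field region and `‖u(t,x)‖ = γ‖u(γ²t, γx)‖ ≤ γM`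
(Chae–Wolf 2017, §2 Step 5). [cite: ChaeWolf2017RemovingDSS, §2 Step 5 (arXiv p. 7)] -/
theorem norm_le_div_norm_of_farField_bound {c : ℝ} (hc : 1 < c) {u : ℝ → E → F}
    (h : IsDiscretelySelfSimilar c u) {δ R M : ℝ} (hδ : 0 < δ) (hR : 0 < R) (hM : 0 ≤ M)
    (hfar : ∀ s ∈ Ioo (-δ) 0, ∀ y : E, R < ‖y‖ → ‖u s y‖ ≤ M)
    {t : ℝ} (ht : t < 0) {x : E} (hx : c * R * Real.sqrt (-t) < Real.sqrt δ * ‖x‖) :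
    ‖u t x‖ ≤ c * R * M / ‖x‖ := by
  have hc0 : 0 < c := one_pos.trans hc
  have hnt : 0 < -t := neg_pos.2 ht
  have hx0 : 0 < ‖x‖ := by
    have h1 : 0 < Real.sqrt δ * ‖x‖ := lt_of_le_of_lt (by positivity) hx
    exact pos_of_mul_pos_right h1 (Real.sqrt_nonneg δ)
  have hxne : ‖x‖ ≠ 0 := hx0.ne'
  -- the power `cⁿ ≤ R/‖x‖ < cⁿ⁺¹ =: γ`
  set ρ : ℝ := R / ‖x‖ with hρ
  have hρ0 : 0 < ρ := div_pos hR hx0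
  obtain ⟨n, hn1, hn2⟩ := exists_mem_Ico_zpow hρ0 hc
  have hγ : c ^ (n + 1) = c ^ n * c := zpow_add_one₀ hc0.ne' n
  have hγ0 : 0 < c ^ (n + 1) := zpow_pos hc0 _
  have hγle : c ^ (n + 1) ≤ c * ρ := by rw [hγ]; nlinarith [hn1, hc0]
  -- the rescaled point lies in the far-field region
  have hy : R < ‖c ^ (n + 1) • x‖ := by
    rw [norm_smul, Real.norm_of_nonneg hγ0.le]
    calc R = ρ * ‖x‖ := by rw [hρ, div_mul_cancel₀ _ hxne]
      _ < c ^ (n + 1) * ‖x‖ := mul_lt_mul_of_pos_right hn2 hx0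
  have hs : (c ^ (n + 1)) ^ 2 * t ∈ Ioo (-δ) 0 := by
    refine ⟨?_, mul_neg_of_pos_of_neg (pow_pos hγ0 2) ht⟩
    -- `γ² (-t) ≤ c² ρ² (-t) = c²R²(-t)/‖x‖² < δ`
    have h1 : (c ^ (n + 1)) ^ 2 * -t ≤ (c * ρ) ^ 2 * -t :=
      mul_le_mul_of_nonneg_right (pow_le_pow_left₀ hγ0.le hγle 2) hnt.le
    have hsq : (c * R * Real.sqrt (-t)) ^ 2 < (Real.sqrt δ * ‖x‖) ^ 2 :=
      pow_lt_pow_left₀ hx (by positivity) two_ne_zero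
    have e1 : (c * R * Real.sqrt (-t)) ^ 2 = (c * ρ) ^ 2 * -t * ‖x‖ ^ 2 := by
      rw [mul_pow, mul_pow, Real.sq_sqrt hnt.le, hρ]
      field_simp
    have e2 : (Real.sqrt δ * ‖x‖) ^ 2 = δ * ‖x‖ ^ 2 := by
      rw [mul_pow, Real.sq_sqrt hδ.le]
    rw [e1, e2] at hsq
    have h2 : (c * ρ) ^ 2 * -t < δ := lt_of_mul_lt_mul_right hsq (by positivity)
    linarith
  have key := hfar _ hs _ hy
  rw [norm_eq_zpow_mul_norm hc0 h (n + 1) t x]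
  calc c ^ (n + 1) * ‖u ((c ^ (n + 1)) ^ 2 * t) (c ^ (n + 1) • x)‖ ≤ c ^ (n + 1) * M :=
        mul_le_mul_of_nonneg_left key hγ0.le
    _ ≤ c * ρ * M := mul_le_mul_of_nonneg_right hγle hM
    _ = c * R * M / ‖x‖ := by rw [hρ]; ring

/-! ### Combining the two rates -/

omit [NormedSpace ℝ E] [NormedSpace ℝ F] in
/-- **Time rate and spatial rate combine to a Type I bound.** If `‖u(t,x)‖ ≤ A/√(−t)` for all
`t < 0`, `x`, and `‖u(t,x)‖ ≤ B/‖x‖ whenever `κ√(−t) < ‖x‖` (`0 < κ`, `0 ≤ A`, `0 ≤ B`), then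
`HasTypeIDecay (max (A(κ+1)) (B(1+κ⁻¹))) u`: in the parabolic region `‖x‖ ≤ κ√(−t)` one has
`‖x‖ + √(−t) ≤ (κ+1)√(−t)`, outside it `‖x‖ + √(−t) ≤ (1+κ⁻¹)‖x‖` (Chae–Wolf 2017, §2 Step 5:
"`√(−t) + |x| ≤ 2 max{|x|, √(−t)}`"). [cite: ChaeWolf2017RemovingDSS, §2 Step 5 (arXiv p. 7)] -/
theorem hasTypeIDecay_of_time_and_space_decay {u : ℝ → E → F} {A B κ : ℝ} (hκ : 0 < κ)
    (hA : 0 ≤ A) (hB : 0 ≤ B)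
    (htime : ∀ t < 0, ∀ x : E, ‖u t x‖ ≤ A / Real.sqrt (-t))
    (hspace : ∀ t < 0, ∀ x : E, κ * Real.sqrt (-t) < ‖x‖ → ‖u t x‖ ≤ B / ‖x‖) :
    HasTypeIDecay (max (A * (κ + 1)) (B * (1 + κ⁻¹))) u := by
  intro t ht x
  set σ : ℝ := Real.sqrt (-t) with hσ
  have hσ0 : 0 < σ := Real.sqrt_pos.2 (neg_pos.2 ht)
  have hden : 0 < ‖x‖ + σ := add_pos_of_nonneg_of_pos (norm_nonneg _) hσ0
  by_cases hcase : ‖x‖ ≤ κ * σ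
  · -- parabolic region: use the time rate
    have h1 : ‖u t x‖ ≤ A / σ := htime t ht x
    have h2 : A / σ ≤ A * (κ + 1) / (‖x‖ + σ) := by
      rw [div_le_div_iff₀ hσ0 hden]
      have : ‖x‖ + σ ≤ (κ + 1) * σ := by linarith
      calc A * (‖x‖ + σ) ≤ A * ((κ + 1) * σ) := mul_le_mul_of_nonneg_left this hA
        _ = A * (κ + 1) * σ := by ring
    exact h1.trans (h2.trans (div_le_div_of_nonneg_right (le_max_left _ _) hden.le))
  · -- outer region: use the spatial rate
    push Not at hcase
    have hx0 : 0 < ‖x‖ := lt_of_le_of_lt (by positivity) hcase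
    have h1 : ‖u t x‖ ≤ B / ‖x‖ := hspace t ht x hcase
    have h2 : B / ‖x‖ ≤ B * (1 + κ⁻¹) / (‖x‖ + σ) := by
      rw [div_le_div_iff₀ hx0 hden]
      have hσle : σ ≤ κ⁻¹ * ‖x‖ := by
        rw [le_inv_mul_iff₀ hκ]; exact hcase.le
      have : ‖x‖ + σ ≤ (1 + κ⁻¹) * ‖x‖ := by linarith
      calc B * (‖x‖ + σ) ≤ B * ((1 + κ⁻¹) * ‖x‖) := mul_le_mul_of_nonneg_left this hB
        _ = B * (1 + κ⁻¹) * ‖x‖ := by ring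
    exact h1.trans (h2.trans (div_le_div_of_nonneg_right (le_max_right _ _) hden.le))

/-! ### Step 5 assembled -/

/-- **Chae–Wolf 2017, proof of Theorem 1.1, Step 5 (far-field regularity + discrete
self-similarity ⇒ the Type I bound (1.5)).** Let `u : ℝ → E → F` (`E` a proper real normed
space) be `c`-discretely self-similar, `1 < c`, continuous on `(−∞, 0) × E`, and bounded on a
far-field region near the final time: `‖u(s, y)‖ ≤ M` for `−δ < s < 0`, `‖y‖ > R` (`0 < δ`). Then
`u` obeys a Type I bound `‖u(t, x)‖ ≤ C/(‖x‖ + √(−t))` for all `t < 0`, `x`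
(`HasTypeIDecay C u`). Printed: "we have shown that `u` is bounded in any set
`ℝ³ × (−∞,0) ∖ Q(0,r)` … `|u(x,t)| ≤ C ∀ (x,t) ∈ Q̄(0,λ) ∖ Q(0,1)` (2.19) … `|u(x,t)| ≤
2Cλ/(√(−t) + |x|)`"; here the bound on the compact part `[−δ/2, −δ/(2c²)] × B̄(0, R')` of one
period strip comes from continuity, the strip bound gives the rate in time
(`norm_le_div_sqrt_of_strip_bound`) and the far-field bound the rate in space
(`norm_le_div_norm_of_farField_bound`). [cite: ChaeWolf2017RemovingDSS, §2, proof of Thm. 1.1, Step 5 with (2.19) (arXiv p. 7)] -/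
theorem exists_hasTypeIDecay_of_farField_bound [ProperSpace E] {c : ℝ} (hc : 1 < c)
    {u : ℝ → E → F} (h : IsDiscretelySelfSimilar c u)
    (hcont : ContinuousOn (uncurry u) (Iio 0 ×ˢ univ)) {δ R M : ℝ} (hδ : 0 < δ)
    (hfar : ∀ s ∈ Ioo (-δ) 0, ∀ y : E, R < ‖y‖ → ‖u s y‖ ≤ M) :
    ∃ C : ℝ, HasTypeIDecay C u := by
  have hc0 : 0 < c := one_pos.trans hc
  -- normalise the far-field data: `0 < R'`, `0 ≤ M'`
  set R' : ℝ := max R 1 with hR'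
  set M' : ℝ := max M 0 with hM'
  have hR'0 : 0 < R' := lt_max_of_lt_right one_pos
  have hM'0 : 0 ≤ M' := le_max_right _ _
  have hfar' : ∀ s ∈ Ioo (-δ) 0, ∀ y : E, R' < ‖y‖ → ‖u s y‖ ≤ M' := fun s hs y hy =>
    (hfar s hs y ((le_max_left _ _).trans_lt hy)).trans (le_max_left _ _)
  -- the period strip `[c²a, a]`, `a = -δ/(2c²)`, inside `(-δ, 0)`
  set a : ℝ := -δ / (2 * c ^ 2) with ha_def
  have hc2 : 0 < c ^ 2 := by positivity
  have ha : a < 0 := div_neg_of_neg_of_pos (neg_neg_of_pos hδ) (by positivity)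
  have hca : c ^ 2 * a = -δ / 2 := by
    rw [ha_def]; field_simp
  have hstrip_sub : Icc (c ^ 2 * a) a ⊆ Ioo (-δ) 0 := by
    rw [hca]
    intro s hs
    exact ⟨by linarith [hs.1], lt_of_le_of_lt hs.2 ha⟩
  -- continuity bounds `u` on the compact part of the strip
  set K : Set (ℝ × E) := Icc (c ^ 2 * a) a ×ˢ closedBall (0 : E) R' with hK
  have hKc : IsCompact K := isCompact_Icc.prod (isCompact_closedBall _ _)
  have hKsub : K ⊆ Iio 0 ×ˢ univ :=
    prod_mono (fun s hs => lt_of_le_of_lt hs.2 ha) (subset_univ _)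
  obtain ⟨C₁, hC₁⟩ := hKc.exists_bound_of_continuousOn (hcont.mono hKsub)
  -- hence on the whole strip
  set M₁ : ℝ := max M' C₁ with hM₁
  have hM₁0 : 0 ≤ M₁ := hM'0.trans (le_max_left _ _)
  have hstrip : ∀ s ∈ Icc (c ^ 2 * a) a, ∀ y : E, ‖u s y‖ ≤ M₁ := by
    intro s hs y
    by_cases hy : R' < ‖y‖
    · exact (hfar' s (hstrip_sub hs) y hy).trans (le_max_left _ _)
    · push Not at hy
      have hmem : (s, y) ∈ K := ⟨hs, mem_closedBall_zero_iff.2 hy⟩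
      exact (hC₁ (s, y) hmem).trans (le_max_right _ _)
  -- the two rates
  have htime := norm_le_div_sqrt_of_strip_bound hc h ha hM₁0 hstrip
  have hκ : 0 < c * R' / Real.sqrt δ := div_pos (mul_pos hc0 hR'0) (Real.sqrt_pos.2 hδ)
  have hspace : ∀ t < 0, ∀ x : E, c * R' / Real.sqrt δ * Real.sqrt (-t) < ‖x‖ →
      ‖u t x‖ ≤ c * R' * M' / ‖x‖ := by
    intro t ht x hx
    refine norm_le_div_norm_of_farField_bound hc h hδ hR'0 hM'0 hfar' ht ?_
    have hsδ : 0 < Real.sqrt δ := Real.sqrt_pos.2 hδ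
    have := mul_lt_mul_of_pos_left hx hsδ
    rwa [← mul_assoc, mul_div_cancel₀ _ hsδ.ne'] at this
  exact ⟨_, hasTypeIDecay_of_time_and_space_decay hκ (by positivity) (by positivity) htime hspace⟩

end ChaeWolfDecay

/-! ### Specialisation to classical solutions on `(−∞, 0)` -/

section Classical

variable {E : Type*} [NormedAddCommGroup E] [InnerProductSpace ℝ E] [FiniteDimensional ℝ E]

/-- **Step 5 for classical solutions.** The velocity of a classical solution of the (forced)
Navier–Stokes system on the time set `(−∞, 0)` is jointly smooth, hence continuous, on
`(−∞, 0) × E`; so if it is `c`-discretely self-similar (`1 < c`) and bounded on a far-field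
region `(−δ, 0) × {‖y‖ > R}`, `0 < δ`, it obeys a Type I bound `HasTypeIDecay C u`
(Chae–Wolf 2017, proof of Thm. 1.1, Step 5, for the solutions of Thm. 1.1, which are
"regular on `Q̄ ∖ {(0,0)}`" by Steps 1–4). [cite: ChaeWolf2017RemovingDSS, §2, proof of Thm. 1.1, Step 5 (arXiv p. 7)] -/
theorem IsClassicalNSSolutionOn.exists_hasTypeIDecay_of_farField_bound {ν c : ℝ} (hc : 1 < c)
    {f u : ℝ → E → E} {p : ℝ → E → ℝ} (hsol : IsClassicalNSSolutionOn (Iio 0) ν f u p)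
    (h : IsDiscretelySelfSimilar c u) {δ R M : ℝ} (hδ : 0 < δ)
    (hfar : ∀ s ∈ Ioo (-δ) 0, ∀ y : E, R < ‖y‖ → ‖u s y‖ ≤ M) :
    ∃ C : ℝ, HasTypeIDecay C u :=
  haveI : ProperSpace E := FiniteDimensional.proper ℝ E
  ChaeWolfDecay.exists_hasTypeIDecay_of_farField_bound hc h
    hsol.smooth_velocity.continuousOn hδ hfar

end Classical



end Literature.Analysis.FluidPDE

end
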